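import Summits.Schanuel.Schanuel.Theorems.RootDecomp1KHyper01
import Literature.Uncategorized.W78LogMeasure

/-!
# RootDecomp1KHyper — part 2 of the «HyperCarving» port wave (lens 6, gen 9 = ROUND 4 of route-Schanuel-RootDecomp1K; 19 parts planned)

Mechanical port (census-1 gen 7, dependency closure; tools census/tools/gen7/portkit2.py + build_l6g9.py) of §17 of HOME/decomp-schanuel-lens-6/g9/HyperCarving.lean
(sha256 aba5c91f…, 8041 l; critic CLEARED FOR TYPING 2026-08-30T13:33:07Z; writer PATH A″ rev 5–8) together with the §§0–16 declarations it depends on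
(nothing of the node was in the tree before except RootDecomp1KLinLiouvilleSplit and the Literature fact NesterenkoWaldschmidt1996_thm_5_1).
This part: node lines 1113–1451 (10 declarations: no_int_relation_of_polyMeasure_liouville, algebraicIndependent_of_polyMeasure_liouville, polyMeasure_of_lenMeasure, polyMeasure_exp_one_of_NW, WMeasure, one_lt_log_log_sixteen …).
All parts share the namespace `Summit.Schanuel.Schanuel.Theorems.RootDecomp1KHyper` (node sub-namespace `HyperCell` reproduced); statements and proofs
are the node's verbatim; `--supports stmt-Schanuel-33363` (A₄ʰ HyperLiouvilleSchanuel). Sorry-free; standard axioms. Nothing here proves Schanuel; rung 0.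
-/

set_option linter.dupNamespace false
set_option linter.unusedSectionVars false

noncomputable section

open Complex IntermediateField Filter Polynomial
open Literature.Uncategorized (W78LogMeasure)

namespace Summit.Schanuel.Schanuel.Theorems.RootDecomp1KHyper

variable {n K : ℕ}

/-- **Liouville extraction, abstract form (Mahler's argument).** No relation
`Σ_{k ≤ K} G_k(θ) ℓ^k = 0` with integer polynomials `G_k`, not all zero, holds between a number
`θ` with a `PolyMeasure` and a Liouville real `ℓ`: specialise `Y := p/q` at a Liouville
approximation of order `m = Kτ + K + 1`; the measure bounds `|q^K P(θ, p/q)|` BELOW by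
`(C (C_q q^K)^τ)⁻¹`, the Lipschitz estimate bounds it ABOVE by `q^K M q^{−m}`; for `q` large the
two are incompatible.  No exponential, no Baker theory: pure Diophantine bookkeeping. -/
theorem no_int_relation_of_polyMeasure_liouville {θ : ℂ} (hθ : PolyMeasure θ) {ℓ : ℝ}
    (hℓ : Liouville ℓ) {K : ℕ} (G : Fin (K + 1) → ℤ[X]) (hG : ∃ k, G k ≠ 0)
    (hrel : ∑ k : Fin (K + 1), aeval θ (G k) * (ℓ : ℂ) ^ (k : ℕ) = 0) : False := by
  -- the complex polynomial μ(Y) = Σ_k G_k(θ) Y^k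
  set μ : ℂ[X] := ∑ k : Fin (K + 1), C (aeval θ (G k)) * X ^ (k : ℕ) with hμdef
  have hμeval : ∀ y : ℂ, μ.eval y = ∑ k : Fin (K + 1), aeval θ (G k) * y ^ (k : ℕ) := by
    intro y
    simp only [hμdef, eval_finsetSum, eval_mul, eval_C, eval_pow, eval_X]
  have hμcoeff : ∀ k : Fin (K + 1), μ.coeff k = aeval θ (G k) := by
    intro k
    simp only [hμdef, finsetSum_coeff, coeff_C_mul, coeff_X_pow]
    rw [Finset.sum_eq_single k]
    · simp
    · intro j _ hjk
      have : (k : ℕ) ≠ (j : ℕ) := fun h => hjk (Fin.ext h).symm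
      simp [this]
    · intro h; exact absurd (Finset.mem_univ k) h
  have hμ0 : μ ≠ 0 := by
    obtain ⟨k, hk⟩ := hG
    intro h0
    have h1 : μ.coeff k = 0 := by rw [h0, coeff_zero]
    rw [hμcoeff] at h1
    exact aeval_ne_zero_of_polyMeasure hθ hk h1
  have hroot : μ.eval (ℓ : ℂ) = 0 := by rw [hμeval]; exact hrel
  obtain ⟨δ, hδ, hδroot⟩ := exists_ball_eval_ne_zero μ hμ0 ℓ
  obtain ⟨M, hM, hLip⟩ := exists_lipschitz_at_root μ ℓ hroot
  -- sizes
  set D : ℕ := Finset.univ.sup fun k : Fin (K + 1) => (G k).natDegree with hDdef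
  have hD : ∀ k, (G k).natDegree ≤ D := fun k =>
    Finset.le_sup (f := fun k : Fin (K + 1) => (G k).natDegree) (Finset.mem_univ k)
  -- the measure in degree D
  obtain ⟨Cm, τ, hCm, hmeas⟩ := hθ D
  set Λ : ℤ := ∑ k : Fin (K + 1), ∑ i ∈ Finset.range (D + 1), |(G k).coeff i| with hΛ
  have hΛ0 : 0 ≤ Λ := Finset.sum_nonneg fun _ _ => Finset.sum_nonneg fun _ _ => abs_nonneg _
  set A : ℕ := ⌈|ℓ|⌉₊ + 2 with hA
  set Cq : ℕ := Λ.toNat * A ^ K + 3 with hCq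
  set m : ℕ := K * τ + K + 1 with hm
  set Q₀ : ℝ := Cm * (Cq : ℝ) ^ τ * M + δ⁻¹ + 1 with hQ₀
  -- a good rational approximation with a large denominator
  obtain ⟨q, ⟨p, hne, hpq⟩, hqQ⟩ :=
    ((hℓ.frequently_exists_num m).and_eventually
      (tendsto_natCast_atTop_atTop.eventually_gt_atTop Q₀)).exists
  have hMCE : 0 ≤ Cm * (Cq : ℝ) ^ τ * M := by positivity
  have hδinv : 0 < δ⁻¹ := inv_pos.mpr hδ
  have hq1 : (1 : ℝ) < q := by
    have : (1 : ℝ) ≤ Q₀ := by rw [hQ₀]; linarith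
    linarith
  have hqpos : (0 : ℝ) < q := by linarith
  have hqR : (q : ℝ) ≠ 0 := hqpos.ne'
  have hq0 : q ≠ 0 := by rintro rfl; simp at hqpos
  have hqinvδ : (q : ℝ)⁻¹ < δ := by
    have h1 : δ⁻¹ < q := by rw [hQ₀] at hqQ; linarith
    exact (inv_lt_comm₀ hδ hqpos).mp h1
  -- r := p/q
  set r : ℝ := (p : ℝ) / q with hr
  have hrℓ : |r - ℓ| < 1 / (q : ℝ) ^ m := by rw [abs_sub_comm]; exact hpq
  have hqm1 : 1 / (q : ℝ) ^ m ≤ (q : ℝ)⁻¹ := by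
    rw [one_div]
    exact inv_anti₀ hqpos (le_self_pow₀ hq1.le (by omega))
  have hrℓ1 : |r - ℓ| ≤ 1 := by
    have : (q : ℝ)⁻¹ ≤ 1 := inv_le_one_of_one_le₀ hq1.le
    linarith
  have hrℓδ : |r - ℓ| < δ := by linarith
  have hrne : r ≠ ℓ := fun h => hne (by rw [← h])
  -- (1) μ(r) ≠ 0
  have hμr : μ.eval (r : ℂ) ≠ 0 := hδroot r hrne hrℓδ
  -- (2) the integer polynomial H = q^K P(X, p/q) and its value at θ
  set H : ℤ[X] := specialise G p q with hH
  have hrC : ((r : ℝ) : ℂ) = (p : ℂ) / (q : ℂ) := by rw [hr]; push_cast; rfl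
  have hHe : aeval θ H = (q : ℂ) ^ K * μ.eval (r : ℂ) := by
    rw [hH, aeval_specialise G p hq0, hμeval, hrC]
  have hqC : (q : ℂ) ≠ 0 := by exact_mod_cast hq0
  have hH0 : H ≠ 0 := by
    intro h0
    have : (q : ℂ) ^ K * μ.eval (r : ℂ) = 0 := by rw [← hHe, h0, map_zero]
    rcases mul_eq_zero.mp this with h | h
    · exact pow_ne_zero K hqC h
    · exact hμr h
  -- (3) upper bound
  have hup : ‖aeval θ H‖ < (q : ℝ) ^ K * M * (1 / (q : ℝ) ^ m) := by
    rw [hHe, norm_mul, norm_pow, Complex.norm_natCast]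
    calc (q : ℝ) ^ K * ‖μ.eval (r : ℂ)‖ ≤ (q : ℝ) ^ K * (M * |r - ℓ|) := by
          gcongr; exact hLip r hrℓ1
      _ < (q : ℝ) ^ K * (M * (1 / (q : ℝ) ^ m)) := by gcongr
      _ = _ := by ring
  -- (4) the length of H
  have hdegH : H.natDegree ≤ D := natDegree_specialise_le G p q hD
  have hpq_bound : (|p| : ℤ) + q ≤ (A : ℤ) * q := by
    have h2 : |(p : ℝ) / q| ≤ |ℓ| + 1 := by
      calc |(p : ℝ) / q| = |(r - ℓ) + ℓ| := by rw [hr]; ring_nf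
        _ ≤ |r - ℓ| + |ℓ| := abs_add_le _ _
        _ ≤ |ℓ| + 1 := by linarith
    rw [abs_div, abs_of_pos hqpos, div_le_iff₀ hqpos] at h2
    have h3 : |ℓ| ≤ ⌈|ℓ|⌉₊ := Nat.le_ceil _
    have h4a : (|ℓ| + 1) * (q : ℝ) ≤ ((⌈|ℓ|⌉₊ : ℝ) + 1) * q :=
      mul_le_mul_of_nonneg_right (by linarith) hqpos.le
    have h4 : |(p : ℝ)| + q ≤ ((⌈|ℓ|⌉₊ : ℝ) + 2) * q := by linarith
    have h5 : (((|p| + q : ℤ)) : ℝ) ≤ (((A : ℤ) * q : ℤ) : ℝ) := by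
      rw [hA]; push_cast; linarith
    exact_mod_cast h5
  have hpq0 : (0 : ℤ) ≤ |p| + q := by positivity
  have hlenH : len H ≤ ((Cq * q ^ K : ℕ) : ℤ) := by
    calc len H ≤ (|p| + q) ^ K * Λ := len_specialise_le G p q hD
      _ ≤ ((A : ℤ) * q) ^ K * Λ := by gcongr
      _ = (A : ℤ) ^ K * (q : ℤ) ^ K * Λ := by ring
      _ ≤ (A : ℤ) ^ K * (q : ℤ) ^ K * Λ.toNat + 3 * (q : ℤ) ^ K := by
          have h1 : Λ ≤ Λ.toNat := Int.self_le_toNat Λ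
          have h2 : (0 : ℤ) ≤ (A : ℤ) ^ K * (q : ℤ) ^ K := by positivity
          have h3 : (0 : ℤ) ≤ 3 * (q : ℤ) ^ K := by positivity
          exact le_add_of_le_of_nonneg (mul_le_mul_of_nonneg_left h1 h2) h3
      _ = ((Cq * q ^ K : ℕ) : ℤ) := by rw [hCq]; push_cast; ring
  have hlenR : ((len H : ℤ) : ℝ) ≤ (Cq : ℝ) * (q : ℝ) ^ K := by
    have h1 : (((len H : ℤ)) : ℝ) ≤ (((Cq * q ^ K : ℕ) : ℤ) : ℝ) := by exact_mod_cast hlenH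
    have h2 : (((Cq * q ^ K : ℕ) : ℤ) : ℝ) = (Cq : ℝ) * (q : ℝ) ^ K := by push_cast; ring
    rw [← h2]; exact h1
  have hlen0 : (0 : ℝ) ≤ ((len H : ℤ) : ℝ) := by exact_mod_cast len_nonneg H
  -- (5) the lower bound of the measure, (6) the clash
  have hlow : 1 ≤ Cm * ((len H : ℤ) : ℝ) ^ τ * ‖aeval θ H‖ := hmeas H hH0 hdegH
  have hlow' : (1 : ℝ) ≤ Cm * ((Cq : ℝ) * (q : ℝ) ^ K) ^ τ * ‖aeval θ H‖ := by
    calc (1 : ℝ) ≤ Cm * ((len H : ℤ) : ℝ) ^ τ * ‖aeval θ H‖ := hlow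
      _ ≤ Cm * ((Cq : ℝ) * (q : ℝ) ^ K) ^ τ * ‖aeval θ H‖ := by gcongr
  have hchain : (1 : ℝ) < Cm * ((Cq : ℝ) * (q : ℝ) ^ K) ^ τ * ((q : ℝ) ^ K * M * (1 / (q : ℝ) ^ m)) :=
    calc (1 : ℝ) ≤ Cm * ((Cq : ℝ) * (q : ℝ) ^ K) ^ τ * ‖aeval θ H‖ := hlow'
      _ < Cm * ((Cq : ℝ) * (q : ℝ) ^ K) ^ τ * ((q : ℝ) ^ K * M * (1 / (q : ℝ) ^ m)) := by gcongr
  have hqm : (q : ℝ) ^ m = (q : ℝ) ^ (K * τ) * (q : ℝ) ^ K * q := by rw [hm]; ring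
  have heq : Cm * ((Cq : ℝ) * (q : ℝ) ^ K) ^ τ * ((q : ℝ) ^ K * M * (1 / (q : ℝ) ^ m))
      = Cm * (Cq : ℝ) ^ τ * M / q := by
    rw [hqm, mul_pow, ← pow_mul]
    field_simp
  rw [heq, lt_div_iff₀ hqpos, one_mul] at hchain
  have : (q : ℝ) < Q₀ := by rw [hQ₀]; linarith
  linarith

/-- **Mahler's class principle, the S_L case (kernel).** A number with a polynomial transcendence
measure in every degree and a Liouville number are algebraically independent over `ℚ`. -/
theorem algebraicIndependent_of_polyMeasure_liouville {θ : ℂ} (hθ : PolyMeasure θ) {ℓ : ℝ}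
    (hℓ : Liouville ℓ) : AlgebraicIndependent ℚ ![θ, (ℓ : ℂ)] := by
  by_contra h
  obtain ⟨K, G, hGK, hrel⟩ := exists_int_relation (transcendental_of_polyMeasure hθ) h
  exact no_int_relation_of_polyMeasure_liouville hθ hℓ G ⟨Fin.last K, hGK⟩ hrel

/-- A measure of the shape `exp(−(A·log H + B)) ≤ |P(θ)|`, valid in degree `≤ d` for all `H ≥ 16`
with `len P ≤ H` (`A ≥ 0`, `A, B` depending on `d` only), is a `PolyMeasure` in degree `d`
(`τ = ⌈A⌉`, `C = e^B · 17^τ`, reading the measure at `H = len P + 16 ≤ 17 · len P`). -/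
theorem polyMeasure_of_lenMeasure {θ : ℂ}
    (h : ∀ d : ℕ, ∃ A B : ℝ, 0 ≤ A ∧ ∀ (P : ℤ[X]) (H : ℕ), P ≠ 0 → P.natDegree ≤ d → 16 ≤ H →
      len P ≤ (H : ℤ) → Real.exp (-(A * Real.log H + B)) ≤ ‖aeval θ P‖) :
    PolyMeasure θ := by
  intro d
  obtain ⟨A, B, hA, hmeas⟩ := h d
  set τ : ℕ := ⌈A⌉₊ with hτ
  have hAτ : A ≤ τ := Nat.le_ceil A
  refine ⟨Real.exp B * 17 ^ τ, τ, by positivity, fun P hP hdeg => ?_⟩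
  set H : ℕ := (len P).toNat + 16 with hH
  have hlen1 : 1 ≤ len P := one_le_len hP
  have hH16 : 16 ≤ H := by omega
  have hHZ : (H : ℤ) = ((len P).toNat : ℤ) + 16 := by rw [hH]; push_cast; ring
  have ht : len P ≤ ((len P).toNat : ℤ) := Int.self_le_toNat _
  have ht' : ((len P).toNat : ℤ) ≤ len P := by rw [Int.toNat_of_nonneg (len_nonneg P)]
  have hlenH : len P ≤ (H : ℤ) := by rw [hHZ]; linarith
  have hH17Z : (H : ℤ) ≤ 17 * len P := by rw [hHZ]; linarith
  have hH17 : (H : ℝ) ≤ 17 * ((len P : ℤ) : ℝ) := by exact_mod_cast hH17Z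
  have hw := hmeas P H hP hdeg hH16 hlenH
  have hHpos : (0 : ℝ) < H := by exact_mod_cast (show 0 < H by omega)
  have hlogH0 : 0 ≤ Real.log H := Real.log_nonneg (by exact_mod_cast (show 1 ≤ H by omega))
  have h1 : (1 : ℝ) ≤ Real.exp (A * Real.log H + B) * ‖aeval θ P‖ := by
    have h3 := mul_le_mul_of_nonneg_left hw (Real.exp_pos (A * Real.log H + B)).le
    rwa [← Real.exp_add, add_neg_cancel, Real.exp_zero] at h3
  have hexpH : Real.exp (A * Real.log H) ≤ (17 : ℝ) ^ τ * ((len P : ℤ) : ℝ) ^ τ := by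
    calc Real.exp (A * Real.log H) ≤ Real.exp ((τ : ℝ) * Real.log H) :=
          Real.exp_le_exp.mpr (mul_le_mul_of_nonneg_right hAτ hlogH0)
      _ = (H : ℝ) ^ τ := by rw [Real.exp_nat_mul, Real.exp_log hHpos]
      _ ≤ (17 * ((len P : ℤ) : ℝ)) ^ τ := pow_le_pow_left₀ hHpos.le hH17 τ
      _ = (17 : ℝ) ^ τ * ((len P : ℤ) : ℝ) ^ τ := mul_pow _ _ _
  calc (1 : ℝ) ≤ Real.exp (A * Real.log H + B) * ‖aeval θ P‖ := h1
    _ = Real.exp B * Real.exp (A * Real.log H) * ‖aeval θ P‖ := by rw [Real.exp_add]; ring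
    _ ≤ Real.exp B * ((17 : ℝ) ^ τ * ((len P : ℤ) : ℝ) ^ τ) * ‖aeval θ P‖ := by gcongr
    _ = Real.exp B * 17 ^ τ * ((len P : ℤ) : ℝ) ^ τ * ‖aeval θ P‖ := by ring

/-- `e` has a `PolyMeasure` (from the Nesterenko–Waldschmidt measure, hypothesis `hNW` = the
verbatim text of the PROVED Literature fact `NesterenkoWaldschmidt1996_thm_4_2`). -/
theorem polyMeasure_exp_one_of_NW (hNW : NWMeasure) : PolyMeasure (cexp 1) := by
  refine polyMeasure_of_lenMeasure fun d => ⟨1.3 * 10 ^ 5 * ((d + 1 : ℕ) : ℝ) ^ 2,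
    1.3 * 10 ^ 5 * ((d + 1 : ℕ) : ℝ) ^ 2 * ((d + 1 : ℕ) : ℝ), by positivity, ?_⟩
  intro P H hP hdeg hH hlen
  have h := hNW P (d + 1) H hP (by omega) (hdeg.trans (by omega))
    (by unfold len at hlen; exact hlen) (by omega)
  rw [ofReal_exp_one] at h
  have e : 1.3 * 10 ^ 5 * ((d + 1 : ℕ) : ℝ) ^ 2 * Real.log H +
      1.3 * 10 ^ 5 * ((d + 1 : ℕ) : ℝ) ^ 2 * ((d + 1 : ℕ) : ℝ) =
      1.3 * 10 ^ 5 * ((d + 1 : ℕ) : ℝ) ^ 2 * (Real.log H + ((d + 1 : ℕ) : ℝ)) := by ring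
  rw [e]; exact h

/-- Verbatim copy of the Literature named fact
`Literature.NumberTheory.Transcendental.Waldschmidt1978_cor_3_9` (Waldschmidt 1978, Cor. 3.9:
transcendence measure for `e^β`, `β ∈ ℚ̄*`), PROVED in the tree (`Waldschmidt1978_cor_3_9_holds`,
`ExpAlgebraicTranscendenceMeasureProofs.lean`, 0 sorry); that module's cone is not built on the
check farm tonight (`remote:stale:unbuilt`), so the cells take it as the hypothesis `hW`
(discharged by name). -/
def WMeasure : Prop :=
  ∀ β : ℂ, IsAlgebraic ℚ β → β ≠ 0 → ∃ C : ℝ, 0 < C ∧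
    ∀ (P : Polynomial ℤ) (N H : ℕ), P ≠ 0 → 1 ≤ N → P.natDegree ≤ N → 16 ≤ H →
      (∀ k, |P.coeff k| ≤ (H : ℤ)) →
      Real.exp (-(C * (N : ℝ) ^ 2 * (Real.log H + Real.log N) *
          (Real.log (Real.log H) + Real.log N) ^ 2 /
          (Real.log (Real.log H) + Real.log (max 1 (Real.log N))) ^ 2)) ≤
        ‖Polynomial.aeval (Complex.exp β) P‖

/-- `log log 16 > 1` (copy of the tree's
`…HeightWindowCompactness.ExpFiniteTypeOfWaldschmidt.one_lt_log_log_sixteen`). -/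
private theorem one_lt_log_log_sixteen : (1 : ℝ) < Real.log (Real.log 16) := by
  have h2 : (0.6931471803 : ℝ) < Real.log 2 := Real.log_two_gt_d9
  have h16 : Real.log 16 = 4 * Real.log 2 := by
    rw [show (16 : ℝ) = 2 ^ 4 by norm_num, Real.log_pow]; norm_num
  have he : Real.exp 1 < Real.log 16 := by
    rw [h16]; have := Real.exp_one_lt_d9; linarith
  rwa [Real.lt_log_iff_exp_lt (by rw [h16]; linarith)]

/-- `e^β`, `β` a non-zero algebraic number, has a `PolyMeasure` (mod `hW`): at fixed `N`,
Waldschmidt's shape is `≤ C N² (1 + log N)² · (log H + log N)` since `log log H > 1`. -/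
theorem polyMeasure_exp_of_W (hW : WMeasure) {β : ℂ} (hβ : IsAlgebraic ℚ β) (hβ0 : β ≠ 0) :
    PolyMeasure (cexp β) := by
  obtain ⟨C, hC, hall⟩ := hW β hβ hβ0
  refine polyMeasure_of_lenMeasure fun d => ?_
  set N : ℕ := d + 1 with hN
  set a : ℝ := C * (N : ℝ) ^ 2 * (1 + Real.log N) ^ 2 with ha
  refine ⟨a, a * Real.log N, by positivity, fun P H hP hdeg hH16 hlen => ?_⟩
  have hcoeff : ∀ k, |P.coeff k| ≤ (H : ℤ) := fun k => (abs_coeff_le_len P k).trans hlen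
  have hw := hall P N H hP (by omega) (hdeg.trans (by omega)) hH16 hcoeff
  have hN1 : (1 : ℝ) ≤ N := by exact_mod_cast (show 1 ≤ N by omega)
  have hH16r : (16 : ℝ) ≤ H := by exact_mod_cast hH16
  have hlogN0 : 0 ≤ Real.log N := Real.log_nonneg hN1
  have hlogH0 : 0 < Real.log H := Real.log_pos (by linarith)
  have hll : 1 < Real.log (Real.log H) :=
    one_lt_log_log_sixteen.trans_le (Real.log_le_log (Real.log_pos (by norm_num : (1 : ℝ) < 16))
      (Real.log_le_log (by norm_num) hH16r))
  have hc0 : 0 ≤ Real.log (max 1 (Real.log N)) := Real.log_nonneg (le_max_left _ _)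
  have hratio : (Real.log (Real.log H) + Real.log N) /
      (Real.log (Real.log H) + Real.log (max 1 (Real.log N))) ≤ 1 + Real.log N := by
    rw [div_le_iff₀ (by linarith)]
    nlinarith
  have hR0 : 0 ≤ (Real.log (Real.log H) + Real.log N) /
      (Real.log (Real.log H) + Real.log (max 1 (Real.log N))) :=
    div_nonneg (by linarith) (by linarith)
  have hshape : C * (N : ℝ) ^ 2 * (Real.log H + Real.log N) *
      (Real.log (Real.log H) + Real.log N) ^ 2 /
      (Real.log (Real.log H) + Real.log (max 1 (Real.log N))) ^ 2 ≤
      a * Real.log H + a * Real.log N := by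
    have hsq := pow_le_pow_left₀ hR0 hratio 2
    have hpos : 0 ≤ C * (N : ℝ) ^ 2 * (Real.log H + Real.log N) := by positivity
    calc C * (N : ℝ) ^ 2 * (Real.log H + Real.log N) * (Real.log (Real.log H) + Real.log N) ^ 2 /
          (Real.log (Real.log H) + Real.log (max 1 (Real.log N))) ^ 2
        = C * (N : ℝ) ^ 2 * (Real.log H + Real.log N) * ((Real.log (Real.log H) + Real.log N) /
            (Real.log (Real.log H) + Real.log (max 1 (Real.log N)))) ^ 2 := by
          rw [div_pow]; ring
      _ ≤ C * (N : ℝ) ^ 2 * (Real.log H + Real.log N) * (1 + Real.log N) ^ 2 :=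
          mul_le_mul_of_nonneg_left hsq hpos
      _ = a * Real.log H + a * Real.log N := by rw [ha]; ring
  exact le_trans (Real.exp_le_exp.mpr (neg_le_neg hshape)) hw

/-- A non-zero logarithm of a non-zero algebraic number has a `PolyMeasure` (mod `hlm`). -/
theorem polyMeasure_log_of_W78 (hlm : W78LogMeasure) {lam : ℂ} (h0 : lam ≠ 0)
    (halg : IsAlgebraic ℚ (cexp lam)) : PolyMeasure lam := by
  obtain ⟨C, hC, hall⟩ := hlm lam h0 halg
  refine polyMeasure_of_lenMeasure fun d => ?_
  set N : ℕ := d + 1 with hN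
  have hlogN0 : 0 ≤ Real.log N := Real.log_natCast_nonneg N
  refine ⟨C * (N : ℝ) ^ 2, C * (N : ℝ) ^ 2 * ((N : ℝ) * Real.log N), by positivity,
    fun P H hP hdeg hH16 hlen => ?_⟩
  have hcoeff : ∀ k, |P.coeff k| ≤ (H : ℤ) := fun k => (abs_coeff_le_len P k).trans hlen
  have hw := hall P N H hP (by omega) (hdeg.trans (by omega)) hH16 hcoeff
  have hlogH0 : 0 ≤ Real.log H := Real.log_natCast_nonneg H
  have hx : 0 ≤ C * (N : ℝ) ^ 2 * (Real.log H + N * Real.log N) := by positivity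
  have hshape : C * (N : ℝ) ^ 2 * (Real.log H + N * Real.log N) / (1 + Real.log N) ≤
      C * (N : ℝ) ^ 2 * Real.log H + C * (N : ℝ) ^ 2 * ((N : ℝ) * Real.log N) := by
    rw [div_le_iff₀ (by linarith)]
    nlinarith [mul_nonneg hx hlogN0]
  exact le_trans (Real.exp_le_exp.mpr (neg_le_neg hshape)) hw

/-- Adjoining an algebraic element does not raise the transcendence degree: `trdeg_K K(x) = 0`
(generic in `K ⊆ E`, so that the `ℚ`-algebra instance path matches `trdeg_adjoin_union_le`). -/
theorem trdeg_adjoin_singleton_eq_zero {K E : Type*} [Field K] [Field E] [Algebra K E] {x : E}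
    (hx : IsIntegral K x) : Algebra.trdeg K ↥(adjoin K ({x} : Set E)) = 0 := by
  haveI : Algebra.IsAlgebraic K ↥(adjoin K ({x} : Set E)) :=
    IntermediateField.isAlgebraic_adjoin fun y hy => by
      rw [Set.mem_singleton_iff] at hy; rw [hy]; exact hx
  exact trdeg_eq_zero

end Summit.Schanuel.Schanuel.Theorems.RootDecomp1KHyper
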